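import Summits.QuantumFields.QCD.Theorems.QuarksAsStableActionStableActionBridgeFockLiftPosDef
import Summits.QuantumFields.QCD.Theorems.QuarksAsStableActionStableActionBridgeSliceNilpotent

/-!
# Gauge covariance of the fermionic transfer operator `T̂_F(U)` from that of `M_F(U)`
(helper for crux stmt-QuantumFields-9737 `QuarksAsStableAction.StableActionBridge`, line `Sketch` —
registered stub `fermionSliceOp_gaugeTransform_of`)

Smit's fermionic one-step transfer operator of `r = 1` Wilson quarks in the background `U`
(*Introduction to Quantum Fields on a Lattice*, §6.5 (6.91); Lüscher 1977) is, in the tree's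
closed form, `T̂_F(U) = (det A(U))² · Γ(M_F(U))` (`fermionSliceOp`), with `Γ = fockLift` the
second-quantisation functor (transported to the linear enumeration `sliceQuarkEquiv` of the slice
quark modes by `Matrix.reindex`), `A(U)` the spin-blind mass-plus-spatial-Wilson term
(`sliceMassHop`) and `M_F(U)` the one-particle matrix (`fermionSliceMatrix`).  A time-independent
gauge transformation `g` acts on the one-particle modes by the rotation `R = sliceGaugeRot g` and
on the Fock space by `Γ(R)` (`fockGaugeAct g`, Smit §4.6 (4.125)–(4.127)).

This file proves the registered implication: IF the one-particle matrix is covariant,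
`M_F(U^g) = R M_F(U) Rᴴ`, and `det A(U^g) = det A(U)`, THEN
`T̂_F(U^g) = Γ(R) T̂_F(U) Γ(R)ᴴ`.  The proof is functoriality of `Γ`
(`FockLiftPosDef.fockLift_mul`, `FockLiftPosDef.fockLift_conjTranspose`), multiplicativity of
`Matrix.reindex e e` (`Matrix.submatrix_mul_equiv`) and its compatibility with `ᴴ`
(`Matrix.conjTranspose_reindex`), and pulling the scalar `(det A)²` through the products
(`Matrix.smul_mul`, `Matrix.mul_smul`).  No unitarity of `R` is used.  Pure theorem file
(no definitions).

[cite: Smit2023, §6.5 (6.91) and §4.6 (4.127)]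
-/

noncomputable section

namespace Summit.QuantumFields.QCD.Cruxes.StableActionBridge.Sketch

open MeasureTheory Matrix Literature.MathematicalPhysics.QuantumFieldTheory
  Literature.MathematicalPhysics.QuantumLattice
open Literature.Probability.LatticeModels (TorusSite)

namespace FermionSliceOpCovariance

/-- `Matrix.reindex e e` is multiplicative on square matrices:
`reindex e e (M N) = reindex e e M * reindex e e N` (a restatement of
`Matrix.submatrix_mul_equiv`). [folklore] -/
theorem reindex_mul_reindex {m n : Type*} [Fintype m] [Fintype n] (e : m ≃ n)
    (M N : Matrix m m ℂ) :
    Matrix.reindex e e (M * N) = Matrix.reindex e e M * Matrix.reindex e e N := by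
  simp only [Matrix.reindex_apply, Matrix.submatrix_mul_equiv]

end FermionSliceOpCovariance

/-- **Gauge covariance of the fermionic transfer operator, from that of its one-particle matrix**
(Smit §6.5 (6.91), §4.6 (4.127)): if `M_F(U^g) = R M_F(U) Rᴴ` with `R = sliceGaugeRot g` the
one-particle gauge rotation, and `det A(U^g) = det A(U)`, then
`T̂_F(U^g) = Γ(R) T̂_F(U) Γ(R)ᴴ` on the slice Fock space, `Γ(R) = fockGaugeAct g`
(`T̂_F(U) = (det A)² Γ(M_F(U))`, `Γ` multiplicative and `ᴴ`-compatible).  Registered sub-goal of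
crux stmt-QuantumFields-9737, line `Sketch`. [cite: Smit2023, §6.5 (6.91) and §4.6 (4.127)] -/
theorem fermionSliceOp_gaugeTransform_of : ∀ (Nf S : ℕ) [NeZero S] (g : Literature.Probability.LatticeModels.TorusSite 3 S → Matrix.specialUnitaryGroup (Fin 3) ℂ) (U : GaugeConfig 3 S (Matrix.specialUnitaryGroup (Fin 3) ℂ)) (mq : Fin Nf → ℝ), fermionSliceMatrix (gaugeTransform g U) mq = sliceGaugeRot (Nf := Nf) g * fermionSliceMatrix U mq * (sliceGaugeRot g)ᴴ → (sliceMassHop (Nf := Nf) (gaugeTransform g U) mq).det = (sliceMassHop (Nf := Nf) U mq).det → fermionSliceOp (gaugeTransform g U) mq = fockGaugeAct g * fermionSliceOp (Nf := Nf) U mq * (fockGaugeAct g)ᴴ := by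
  intro Nf S _ g U mq hM hdet
  unfold fermionSliceOp fockGaugeAct
  rw [hM, hdet, FermionSliceOpCovariance.reindex_mul_reindex,
    FermionSliceOpCovariance.reindex_mul_reindex, ← Matrix.conjTranspose_reindex,
    FockLiftPosDef.fockLift_mul, FockLiftPosDef.fockLift_mul,
    FockLiftPosDef.fockLift_conjTranspose, Matrix.mul_smul, Matrix.smul_mul]

end Summit.QuantumFields.QCD.Cruxes.StableActionBridge.Sketch

end
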